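import Literature.Geometry.Lorentzian.CauchyDevelopmentGlobalHyperbolicity
import Literature.Geometry.Lorentzian.CauchyHypersurfaceGlobalHyperbolicity
import HarnessLib

/-!
# Cauchy developments are globally hyperbolic: discharge of
# `hawkingEllis_cauchyDevelopment_causalCompact_closed` (Hawking–Ellis 1973, Prop. 6.6.3, 6.6.6;
# O'Neill 1983, Cor. 14.39, Lemma 14.40, Lemma 14.22)

For a Cauchy development `𝒟 = (M, g, τ, ι, ν)` of initial data on a connected `n`-manifold `X`
(`CauchyDevelopment.lean`: `ι(X)` is a Cauchy hypersurface of the spacetime `(M, g, τ)`), the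
general results of `CauchyHypersurfaceGlobalHyperbolicity.lean` (a spacetime with a Cauchy
hypersurface has closed causal relation, compact `J⁻(x) ∩ J⁺(S)` and `J⁺(x) ∩ J⁻(S)`, compact
causal diamonds) give:

* `CauchyDevelopment.mem_causalFuture_of_tendsto` — the causal relation is (sequentially) closed
  (O'Neill 1983, Lemma 14.22); `CauchyDevelopment.isClosed_causalFuture_singleton`,
  `….isClosed_causalPast_singleton`;
* `CauchyDevelopment.isCompact_causalPast_inter_causalFuture_range` — `J⁻(x) ∩ J⁺(ι X)` is compact
  (Hawking–Ellis 1973, Prop. 6.6.6; O'Neill 1983, Lemma 14.40), and its time dual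
  `….isCompact_causalFuture_inter_causalPast_range`;
* `CauchyDevelopment.isGloballyHyperbolic` — **a Cauchy development is globally hyperbolic**
  (causal with compact causal diamonds): O'Neill 1983,
  Cor. 14.39; Hawking–Ellis 1973, Prop. 6.6.3; Geroch 1970, Thm. 11 — and hence strongly causal,
  `CauchyDevelopment.isStronglyCausal` (Bernal–Sánchez 2007, Thm. 3.2);
* `hawkingEllis_cauchyDevelopment_causalCompact_closed_holds` — **discharge of the named fact** of
  `CauchyDevelopmentGlobalHyperbolicity.lean` (the displayed hypotheses `hK`, `hrel` of the
  Cauchy-problem files `SpacelikeBoundaryFuturePoint`, `CorrespondingBoundaryShadow`,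
  `CorrespondingBoundaryDomain`).

Everything is proved; no definitions and no named facts are introduced (D-0026).

## References

* S. W. Hawking, G. F. R. Ellis, *The large scale structure of space-time*, CUP 1973, §6.6,
  Prop. 6.6.3 and Prop. 6.6.6 (pp. 206–211). [HawkingEllis1973CUP]
* B. O'Neill, *Semi-Riemannian geometry with applications to relativity*, Academic Press 1983,
  Ch. 14, Lemma 14.22 (p. 412), Thm. 14.38, Cor. 14.39, Lemma 14.40 (pp. 421–423).
  [ONeillSemiRiemannian1983]
* A. N. Bernal, M. Sánchez, Class. Quantum Grav. 24 (2007) 745–749, Thm. 3.2. [BernalSanchez2007CQG]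
* R. Geroch, *Domain of dependence*, J. Math. Phys. 11 (1970) 437–449, Thm. 11.
-/

noncomputable section

open Bundle Set Filter Function Topology TopologicalSpace
open scoped Manifold ContDiff Topology

namespace Literature.Geometry.Lorentzian

universe u

variable {n : ℕ} {X : Type u} [TopologicalSpace X] [ChartedSpace (EuclideanSpace ℝ (Fin n)) X]
  [IsManifold (𝓡 n) ∞ X] [ConnectedSpace X] {D : InitialDataSet (𝓡 n) X}

namespace CauchyDevelopment

/-- The Levi-Civita connection of the metric of a Cauchy development is `C¹` (indeed smooth), in the
form of the instance used by the exponential-map files. [folklore] -/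
private theorem contMDiffCovariantDerivative_leviCivita (𝒟 : CauchyDevelopment D) :
    ∀ [𝒟.metric.HasLeviCivita],
      CovariantDerivative.ContMDiffCovariantDerivative 𝒟.metric.leviCivita 1 := by
  intro _
  haveI : Fact ((1 : ℕ∞ω) ≤ ∞) := ⟨by exact_mod_cast le_top⟩
  exact ⟨𝒟.metric.toPseudoRiemannianMetric.isLocallyContMDiff_leviCivita_holds 1
    (by rw [show ((1 : ℕ∞) : ℕ∞ω) + 1 = 2 by norm_num]; exact WithTop.coe_le_coe.2 le_top)
    univ isOpen_univ⟩

/-- **The causal relation of a Cauchy development is closed** (O'Neill 1983, Ch. 14, Lemma 14.22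
with Cor. 14.39): if `xⱼ → x`, `yⱼ → y` and `yⱼ ∈ J⁺(xⱼ)` for all `j`, then `y ∈ J⁺(x)`.
[cite: ONeillSemiRiemannian1983, Ch. 14, Lemma 14.22 (p. 412)] -/
theorem mem_causalFuture_of_tendsto (𝒟 : CauchyDevelopment D) {xs ys : ℕ → 𝒟.carrier}
    {x y : 𝒟.carrier} (hx : Tendsto xs atTop (𝓝 x)) (hy : Tendsto ys atTop (𝓝 y))
    (hxy : ∀ j, ys j ∈ 𝒟.metric.causalFuture 𝒟.timeOrientation {xs j}) :
    y ∈ 𝒟.metric.causalFuture 𝒟.timeOrientation {x} := by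
  haveI : 𝒟.metric.HasLeviCivita := 𝒟.metric.toPseudoRiemannianMetric.hasLeviCivita
  haveI := 𝒟.contMDiffCovariantDerivative_leviCivita
  exact 𝒟.isCauchyHypersurface.mem_causalFuture_of_tendsto le_rfl hx hy hxy

/-- **`J⁺(x)` is closed in a Cauchy development** (O'Neill 1983, Ch. 14, Lemma 14.22).
[cite: ONeillSemiRiemannian1983, Ch. 14, Lemma 14.22 (p. 412)] -/
theorem isClosed_causalFuture_singleton (𝒟 : CauchyDevelopment D) (x : 𝒟.carrier) :
    IsClosed (𝒟.metric.causalFuture 𝒟.timeOrientation {x}) := by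
  haveI : 𝒟.metric.HasLeviCivita := 𝒟.metric.toPseudoRiemannianMetric.hasLeviCivita
  haveI := 𝒟.contMDiffCovariantDerivative_leviCivita
  exact 𝒟.isCauchyHypersurface.isClosed_causalFuture_singleton le_rfl x

/-- **`J⁻(x)` is closed in a Cauchy development** (O'Neill 1983, Ch. 14, Lemma 14.22).
[cite: ONeillSemiRiemannian1983, Ch. 14, Lemma 14.22 (p. 412)] -/
theorem isClosed_causalPast_singleton (𝒟 : CauchyDevelopment D) (x : 𝒟.carrier) :
    IsClosed (𝒟.metric.causalPast 𝒟.timeOrientation {x}) := by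
  haveI : 𝒟.metric.HasLeviCivita := 𝒟.metric.toPseudoRiemannianMetric.hasLeviCivita
  haveI := 𝒟.contMDiffCovariantDerivative_leviCivita
  exact 𝒟.isCauchyHypersurface.isClosed_causalPast_singleton le_rfl x

/-- **`J⁻(x) ∩ J⁺(ι X)` is compact in a Cauchy development** (Hawking–Ellis 1973, Prop. 6.6.6:
*"If `q ∈ int D(𝒮)`, then `J⁺(𝒮) ∩ J⁻(q)` is compact or empty"*; O'Neill 1983, Lemma 14.40).
[cite: HawkingEllis1973CUP, §6.6, Prop. 6.6.6 (p. 211)] -/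
theorem isCompact_causalPast_inter_causalFuture_range (𝒟 : CauchyDevelopment D)
    (x : 𝒟.carrier) :
    IsCompact (𝒟.metric.causalPast 𝒟.timeOrientation {x} ∩
      𝒟.metric.causalFuture 𝒟.timeOrientation (range 𝒟.embed)) := by
  haveI : 𝒟.metric.HasLeviCivita := 𝒟.metric.toPseudoRiemannianMetric.hasLeviCivita
  haveI := 𝒟.contMDiffCovariantDerivative_leviCivita
  exact 𝒟.isCauchyHypersurface.isCompact_causalPast_inter_causalFuture le_rfl x

/-- **`J⁺(x) ∩ J⁻(ι X)` is compact in a Cauchy development** (Hawking–Ellis 1973, Prop. 6.6.6,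
time dual). [cite: HawkingEllis1973CUP, §6.6, Prop. 6.6.6 (p. 211)] -/
theorem isCompact_causalFuture_inter_causalPast_range (𝒟 : CauchyDevelopment D)
    (x : 𝒟.carrier) :
    IsCompact (𝒟.metric.causalFuture 𝒟.timeOrientation {x} ∩
      𝒟.metric.causalPast 𝒟.timeOrientation (range 𝒟.embed)) := by
  haveI : 𝒟.metric.HasLeviCivita := 𝒟.metric.toPseudoRiemannianMetric.hasLeviCivita
  haveI := 𝒟.contMDiffCovariantDerivative_leviCivita
  exact 𝒟.isCauchyHypersurface.isCompact_causalFuture_inter_causalPast le_rfl x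

/-- **Causal diamonds of a Cauchy development are compact** (O'Neill 1983, Thm. 14.38 (3) with
Cor. 14.39). [cite: ONeillSemiRiemannian1983, Ch. 14, Thm. 14.38 (3) (p. 422)] -/
theorem isCompact_causalDiamond (𝒟 : CauchyDevelopment D) (p q : 𝒟.carrier) :
    IsCompact (𝒟.metric.causalFuture 𝒟.timeOrientation {p} ∩
      𝒟.metric.causalPast 𝒟.timeOrientation {q}) := by
  haveI : 𝒟.metric.HasLeviCivita := 𝒟.metric.toPseudoRiemannianMetric.hasLeviCivita
  haveI := 𝒟.contMDiffCovariantDerivative_leviCivita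
  exact 𝒟.isCauchyHypersurface.isCompact_causalDiamond le_rfl p q

/-- **A Cauchy development is globally hyperbolic** (`IsGloballyHyperbolic`: no closed causal
curves and compact causal diamonds, `IsCauchyHypersurface.isGloballyHyperbolic`). O'Neill 1983,
Ch. 14, Cor. 14.39 (*"If `M` has a Cauchy hypersurface, then `M` is globally hyperbolic"*);
Hawking–Ellis 1973, Prop. 6.6.3; Geroch 1970, Thm. 11.
[cite: ONeillSemiRiemannian1983, Ch. 14, Cor. 14.39 (p. 423)] -/
theorem isGloballyHyperbolic (𝒟 : CauchyDevelopment D) :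
    𝒟.metric.IsGloballyHyperbolic 𝒟.timeOrientation := by
  haveI : 𝒟.metric.HasLeviCivita := 𝒟.metric.toPseudoRiemannianMetric.hasLeviCivita
  haveI := 𝒟.contMDiffCovariantDerivative_leviCivita
  exact 𝒟.isCauchyHypersurface.isGloballyHyperbolic le_rfl

/-- **A Cauchy development is strongly causal** (O'Neill 1983, Ch. 14, Thm. 14.38 (2)), via
Bernal–Sánchez 2007, Thm. 3.2 from global hyperbolicity.
[cite: ONeillSemiRiemannian1983, Ch. 14, Thm. 14.38 (2) (p. 421)] -/
theorem isStronglyCausal (𝒟 : CauchyDevelopment D) :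
    𝒟.metric.IsStronglyCausal 𝒟.timeOrientation := by
  haveI : 𝒟.metric.HasLeviCivita := 𝒟.metric.toPseudoRiemannianMetric.hasLeviCivita
  haveI := 𝒟.contMDiffCovariantDerivative_leviCivita
  exact 𝒟.isCauchyHypersurface.isStronglyCausal le_rfl

end CauchyDevelopment

/-- **Discharge of `hawkingEllis_cauchyDevelopment_causalCompact_closed`** (Hawking–Ellis 1973,
Prop. 6.6.6 with its time dual, and O'Neill 1983, Lemma 14.22 via Prop. 6.6.3, for Cauchy
developments in dimension `3 + 1`): (i) `J⁻(x) ∩ J⁺(ι X)` is compact; (ii) `J⁺(x) ∩ J⁻(ι X)` is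
compact; (iii) the causal relation is sequentially closed. Proved for all dimensions in
`CauchyDevelopment.isCompact_causalPast_inter_causalFuture_range`,
`….isCompact_causalFuture_inter_causalPast_range`, `….mem_causalFuture_of_tendsto`, from the
limit-sequence machinery of `CauchyHypersurfaceGlobalHyperbolicity.lean`.
[cite: HawkingEllis1973CUP, §6.6, Prop. 6.6.6 and Prop. 6.6.3 (p. 211)]
[cite: ONeillSemiRiemannian1983, Ch. 14, Lemma 14.22 (p. 412)] -/
theorem hawkingEllis_cauchyDevelopment_causalCompact_closed_holds :
    hawkingEllis_cauchyDevelopment_causalCompact_closed := by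
  intro X _ _ _ _ D 𝒟
  exact ⟨𝒟.isCompact_causalPast_inter_causalFuture_range,
    𝒟.isCompact_causalFuture_inter_causalPast_range,
    fun xs ys x y hx hy hxy ↦ 𝒟.mem_causalFuture_of_tendsto hx hy hxy⟩

end Literature.Geometry.Lorentzian

end
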